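import Literature.NumberTheory.Automorphic.Liu2021.AlbaneseGaloisDescent
import Literature.NumberTheory.Automorphic.Liu2021.NablaGaloisDescent
import Literature.NumberTheory.Automorphic.Liu2021.SplittingField
import Literature.NumberTheory.Automorphic.Liu2021.AlbaneseOfPiecesSubfieldComplex
import Literature.NumberTheory.Automorphic.Liu2021.AppendixC.Sec42OfExistsAlbanese
import Mathlib.NumberTheory.NumberField.InfinitePlace.Embeddings
import HarnessLib

/-!
# Liu 2021 §2.1, Prop. 2.2: the Albanese variety of a smooth projective scheme over a field of
# characteristic zero embeddable in `ℂ` EXISTS — and §4.2's `Sec42Data` is inhabited WITHOUT `exists_albanese`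

[Liu2021] = Yifeng Liu, *Fourier–Jacobi cycles and arithmetic relative trace formula*, Camb. J. Math.
**9** (2021) = arXiv:2102.11518.  Numbering of arXiv:2102.11518v2 (Prop. 2.2, Def. 2.3, Lemma 2.4); line numbers
`l. NNNN` refer to the author's TeX source `FJcycle.tex` (md5 `6db49a74122d2cb0f224fa1b39488a0c`), as in
`Liu2021/AppendixC/Glue.lean`.  §2.1, Prop. 2.2 (FJcycle.tex l. 1190–1192): «Let `X` be a proper
smooth scheme in `Sch_{/k}`. […] Then `\\underline{Alb}_X` is corepresentable», typed in the tree as the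
NAMED FACT `Liu2021.exists_albanese` (`Liu2021/AlbaneseBaseChange.lean`) — over every field, for every
proper smooth `X`.  THIS FILE (PROOF FILE: theorems only, no definition, no named fact, sorry-free)
PROVES the case the COR-CM consumer uses — `k` of characteristic zero admitting an embedding into `ℂ`
(e.g. a number field), `X` smooth of some relative dimension and PROJECTIVE — by the printed proof
(l. 1194–1200) with «separable closure» replaced by a finite Galois extension:

  «Let `k'` be a separable closure of `k`. Then `k'` splits `X` […]» — `exists_isGalois_isColimit_isSmoothProjective`
  (`Liu2021/SplittingField`): a finite Galois `L / k` over which `X_L` is a finite coproduct of smooth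
  projective geometrically irreducible varieties;
  «By Serre's construction [Ser59] of the Albanese variety […] corepresents the functor `\\underline{Alb}_{X'}`»
  — `Albanese.nonempty_of_isColimit_of_algebra_complex` (`Liu2021/AlbaneseOfPiecesSubfieldComplex`, with
  Milne's point-free Albanese data of the pieces from `Motives/AlbaneseExistenceSubfieldComplex`);
  «As `(∇X)_{k'} ≃ ∇_{k'}X'`» — `Nabla.exists_of_nabla_baseChange` (`Liu2021/NablaGaloisDescent`);
  «the statement for `X` then follows by Galois descent» — `Albanese.nonempty_of_albanese_baseChange`
  (`Liu2021/AlbaneseGaloisDescent`).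

* `Albanese.nonempty_of_isProjectiveOver` — **`Nonempty (AppendixC.Albanese X)` for `X` smooth of relative
  dimension `d` and projective over a field `k` of characteristic zero with `[Algebra k ℂ]`.**
* `Sec42Data.nonempty` — **the standing datum of §4.2 (`AppendixC.Sec42Data`, `Liu2021/AppendixC/Glue`)
  is inhabited for every `(n ≥ 2, S, projectivity clause, cpt)` WITHOUT the hypothesis
  `(hA : exists_albanese)`** of `Sec42Data.nonempty_of_exists_albanese` (`AppendixC/Sec42OfExistsAlbanese`):
  the compactified Shimura varieties `X_K = S̃h(𝕍)_K` are «smooth projective […] of dimension `n − 1`»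
  over the CM number field `E` (§4.2 l. 2064), which embeds into `ℂ`.

What is NOT claimed: the named fact `exists_albanese` itself (all fields, including positive
characteristic; proper but non-projective `X`) stays a cited statement; `albanese_baseChange`
([FGA VI, Thm. 3.3 (iii)], `Liu2021/AlbaneseBaseChangeFact`) is untouched.  HC_CM is NOT proved; nothing
here discharges any COR-CM binder: the Appendix-C carrier `Sec42Data` of the closed term stays posited —
this file is its Albanese-side NON-VACUITY exit by name, now unconditional (TEAM hComp referee ruling R-2).

Relies on: nothing unproved (axioms `propext`, `Classical.choice`, `Quot.sound`).

## References

* [Liu2021] Y. Liu, arXiv:2102.11518 = Camb. J. Math. 9 (2021), §2.1 Prop. 2.2 (v2 numbering; FJcycle.tex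
  l. 1190–1192) with proof (l. 1194–1200), Def. 2.3 (l. 1202–1208); §4.2 l. 2053–2070; App. C Def. C.8.
* [Milne1986JacobianVarieties] J. S. Milne, *Jacobian Varieties* (1986), Remark 1.9, §6 Prop. 6.4.
* [Serre1958MorphismesUniversels] J.-P. Serre, *Morphismes universels et variété d'Albanese*,
  Sém. Chevalley 4 (1958/59), exp. 10 (Liu's [Ser59]).
-/

noncomputable section

open CategoryTheory CategoryTheory.Limits AlgebraicGeometry MonoidalCategory CartesianMonoidalCategory NumberField
open Literature.AlgebraicGeometry.Motives

namespace Literature.NumberTheory.Automorphic.Liu2021.AppendixC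

open AbelianVariety (bcSpec bcFunctor)

set_option backward.isDefEq.respectTransparency false

/-! ### The hypotheses of the descent for `∇X ⊆ X × X`, `X` smooth -/

/-- For `X` smooth of relative dimension `d` over `k`, `(X × X)_L` is reduced (it is smooth of relative
dimension `d + d` over `L`; tree `isReduced_of_smoothOfRelativeDimension`). [folklore] -/
private theorem isReduced_bc_tensor {k : Type} [Field k] (L : Type) [Field L] [Algebra k L] {d : ℕ}
    (X : SchemeOver k) [SmoothOfRelativeDimension d X.hom] :
    IsReduced (GaloisDescent.bc L (X ⊗ X)) := by
  haveI := smoothOfRelativeDimension_isStableUnderBaseChange (n := d)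
  haveI : SmoothOfRelativeDimension d (pullback.fst X.hom X.hom) :=
    MorphismProperty.pullback_fst _ _ ‹_›
  haveI : SmoothOfRelativeDimension (d + d) (X ⊗ X).hom := by
    rw [Over.tensorObj_hom]; infer_instance
  haveI : SmoothOfRelativeDimension (d + d) ((bcFunctor k L).obj (X ⊗ X)).hom := by
    haveI := smoothOfRelativeDimension_isStableUnderBaseChange (n := d + d)
    exact MorphismProperty.pullback_snd _ _ ‹_›
  exact isReduced_of_smoothOfRelativeDimension ((bcFunctor k L).obj (X ⊗ X)).hom (d + d)

/-- For a `∇X` (Def. 2.1 (1)) of `X` smooth over `k`: `(∇X)_L` is reduced (an open subscheme of the reduced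
`(X × X)_L`) and `∇X → Spec k` is locally of finite type. [folklore] -/
private theorem Nabla.isReduced_bc_and_locallyOfFiniteType {k : Type} [Field k] (L : Type) [Field L] [Algebra k L]
    {d : ℕ} {X : SchemeOver k} [SmoothOfRelativeDimension d X.hom] (N : Nabla X) :
    IsReduced (GaloisDescent.bc L N.N) ∧ LocallyOfFiniteType N.N.hom := by
  haveI := N.isOpenImmersion_incl
  haveI : IsReduced ((bcFunctor k L).obj (X ⊗ X)).left := isReduced_bc_tensor L X (d := d)
  haveI := GaloisDescent.isOpenImmersion_bcFunctor_map_left L N.incl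
  haveI := smoothOfRelativeDimension_isStableUnderBaseChange (n := d)
  haveI : SmoothOfRelativeDimension d (pullback.fst X.hom X.hom) :=
    MorphismProperty.pullback_fst _ _ ‹_›
  haveI : SmoothOfRelativeDimension (d + d) (X ⊗ X).hom := by
    rw [Over.tensorObj_hom]; infer_instance
  haveI : Smooth (X ⊗ X).hom := SmoothOfRelativeDimension.smooth (d + d) _
  refine ⟨isReduced_of_isOpenImmersion ((bcFunctor k L).map N.incl).left, ?_⟩
  rw [← Over.w N.incl]
  infer_instance

/-! ### Liu's Prop. 2.2 for smooth projective schemes over subfields of `ℂ` -/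

/-- **[Liu2021, Prop. 2.2 + Def. 2.3 (arXiv:2102.11518v2 numbering)] — the Albanese variety EXISTS, for `X`
smooth PROJECTIVE over a field of characteristic zero embeddable in `ℂ`** (the named fact `exists_albanese`
as typed — all fields, proper smooth `X` — is NOT claimed).  For a field `k` with `[CharZero k]`, `[Algebra k ℂ]`, and a
`k`-scheme `X` smooth of relative dimension `d` and projective, `AppendixC.Albanese X` (Def. 2.3: `∇X`,
a real abelian variety `Alb_X` over `k`, the Albanese morphism `α_X : ∇X → Alb_X`, corepresentability) is
inhabited.  Proof = the printed proof (l. 1194–1200) with a FINITE Galois splitting field: split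
(`exists_isGalois_isColimit_isSmoothProjective`), Albanese data of the split scheme
(`Albanese.nonempty_of_isColimit_of_algebra_complex`, along any `k`-embedding `L → ℂ`), descend `∇`
(`Nabla.exists_of_nabla_baseChange`) and the datum (`Albanese.nonempty_of_albanese_baseChange`).  Ours.
[cite: Liu2021, Prop. 2.2 and Def. 2.3 (arXiv:2102.11518v2 numbering), FJcycle.tex l. 1190–1192 with printed proof l. 1194–1200 and l. 1202–1208]
[cite: Milne1986JacobianVarieties, Remark 1.9 and §6 Prop. 6.4] [cite: Serre1958MorphismesUniversels, exp. 10] -/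
theorem Albanese.nonempty_of_isProjectiveOver {k : Type} [Field k] [CharZero k] [Algebra k ℂ] {d : ℕ}
    (X : SchemeOver k) [SmoothOfRelativeDimension d X.hom] (hX : IsProjectiveOver X) :
    Nonempty (Albanese X) := by
  obtain ⟨L, _, _, _, _, C, _, E, e, hE, ⟨hcol⟩⟩ :=
    exists_isGalois_isColimit_isSmoothProjective (d := d) X hX
  haveI : Fintype C := Fintype.ofFinite C
  letI : Algebra L ℂ := ((IsAlgClosed.lift : L →ₐ[k] ℂ) : L →+* ℂ).toAlgebra
  obtain ⟨a'⟩ := Albanese.nonempty_of_isColimit_of_algebra_complex hcol (d := fun _ => d) hE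
  obtain ⟨N, e', he'⟩ := Nabla.exists_of_nabla_baseChange L a'.nabla
  obtain ⟨h1, h2⟩ := Nabla.isReduced_bc_and_locallyOfFiniteType L (d := d) N
  haveI := h1
  haveI := h2
  exact Albanese.nonempty_of_albanese_baseChange L N a' e' he'

/-- The same for the attributes printed for Liu's `X_K = S̃h(𝕍)_K` in §4.2 l. 2064 («smooth projective
schemes in `Sch_{/E}` of dimension `n − 1`») over a number field `E` (which embeds into `ℂ`).  Ours.
[cite: Liu2021, §4.2 FJcycle.tex l. 2060–2066 and Prop. 2.2 (arXiv:2102.11518v2 numbering)] -/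
theorem Albanese.nonempty_of_numberField {E : Type} [Field E] [NumberField E] {d : ℕ} (X : SchemeOver E)
    [SmoothOfRelativeDimension d X.hom] (hX : IsProjectiveOver X) : Nonempty (Albanese X) :=
  letI : Algebra E ℂ := (Classical.choice (inferInstance : Nonempty (E →+* ℂ))).toAlgebra
  Albanese.nonempty_of_isProjectiveOver (d := d) X hX

/-! ### §4.2: `Sec42Data` is inhabited, unconditionally on the Albanese side -/

variable {F E : Type} [Field F] [NumberField F] [IsTotallyReal F] [Field E] [NumberField E] [Algebra F E]
  [IsTotallyComplex E] [Algebra.IsQuadraticExtension F E]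

/-- **`Sec42Data` WITHOUT `exists_albanese`.**  Given «`n ≥ 2`» (l. 2053), a system `S` of Shimura varieties
associated to `𝕍` (Prop. C.5 / Def. C.6), the printed projectivity clause (l. 2060) and the compactified
system `cpt` (Def. C.8, with `X_K` «smooth projective … of dimension `n − 1`», l. 2064), the standing data of
§4.2 exist: `Sec42Data.ofAlbanese` (`AppendixC/AlbaneseFunctorial.lean`) at the Albanese data of the
`X_K` that now EXIST by `Albanese.nonempty_of_numberField` (Liu's Prop. 2.2 of §2.1, proved for smooth
projective schemes over number fields) — the hypothesis `(hA : exists_albanese)` of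
`Sec42Data.nonempty_of_exists_albanese` is discharged.  Ours (assembly).
[cite: Liu2021, §4.2 FJcycle.tex l. 2053–2070; Prop. 2.2 and Def. 2.3 (arXiv:2102.11518v2 numbering), FJcycle.tex l. 1190–1208] -/
theorem Sec42Data.nonempty {P5 : PropC5Data F E} (isotropicAt : ℕ → Prop)
    (two_le_n : 2 ≤ P5.n) (S : IncoherentShimuraSystem P5)
    (hproj : ∀ K, IsProjectiveOver (S.Sh𝕍.obj K) ↔
      ¬ (Module.finrank ℚ F = 1 ∧ (3 ≤ P5.n ∨ (P5.n = 2 ∧ ∀ p : ℕ, p.Prime → isotropicAt p))))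
    (cpt : CompactifiedSystem S) : Nonempty (Sec42Data P5 isotropicAt) :=
  ⟨Sec42Data.ofAlbanese two_le_n S hproj cpt fun K =>
    haveI := cpt.smooth_X K
    (Albanese.nonempty_of_numberField (d := P5.n - 1) (cpt.X.obj K) (cpt.projective_X K)).some⟩

end Literature.NumberTheory.Automorphic.Liu2021.AppendixC

end
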